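import Literature.NumberTheory.GaloisRepresentations.LubinTateColemanSeries
import HarnessLib

/-!
# Galois equivariance of the Coleman power series: `g_{σβ} = g_β ∘ [χ_π(σ)]_f`

De Shalit, *Iwasawa theory of elliptic curves with complex multiplication* (1987), Ch. I §2.3 Corollary (iv)
(and (15) of §3.7): for a norm-coherent sequence of units `β ∈ 𝒰 = lim← U(K_π^{m+1})` of the Lubin–Tate
tower of `f = πX + X^q` over a non-archimedean local field `F` and `σ ∈ Γ_F = Gal(F̄/F)`, the Coleman power
series of `σβ = (σ β_m)_m` is **`g_{σβ} = g_β ∘ [χ_π(σ)]_f`**, where `χ_π : Γ_F → 𝒪_Fˣ` is the Lubin–Tate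
character (`lubinTateChar`). Equivalently, Coleman's bijection `𝒰 ≅ ℳ_f = {g : 𝒩g = g, g(0) ∈ 𝒪_Fˣ}`
(`colemanSeries`, `LubinTateColemanSeries.lean`) is `Γ_F`-equivariant for the action `g ↦ g ∘ [χ_π(σ)]_f` on
power series. Everything **proved**:

* `galRestrict hπ m σ ∈ Gal(K_π^{m+1}/F)` — the restriction of `σ ∈ Γ_F`; `coe_galRestrict_apply`;
  `galRestrict_eq_galOfUnit` : **it is the automorphism `σ_{χ_π(σ)}`** (`σ λ_{m+1} = [χ_π(σ)] λ_{m+1}`).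
* `galOfUnit_inclusion` — the `σ_v` of the various levels are compatible with the tower inclusions;
  `algEquiv_mul_comm` — `Gal(K_π^{m+1}/F)` is commutative; `algEquiv_towerNorm` — automorphisms commute with
  the relative norms `N_{K_π^{m+1}/K_π^{n+1}}`.
* `NormCoherentUnits.unitAct v β = (σ_v β_m)_m` and `NormCoherentUnits.galAct σ β = (σ β_m)_m` — the actions of
  `𝒪_Fˣ` and of `Γ_F` on `𝒰`; `galAct_eq_unitAct`.
* ★ `colemanSeries_unitAct` : **`g_{σ_v β} = g_β ∘ [v]_f`** and ★ `colemanSeries_galAct` :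
  **`g_{σβ} = g_β ∘ [χ_π(σ)]_f`**.

## References

* E. de Shalit, *Iwasawa theory of elliptic curves with complex multiplication* (1987), Ch. I §2.3
  Corollary (iv); §3.7 (15). [cite: deShalit1987, Ch. I §2.3 (iv)]
* J.-P. Serre, *Local class field theory*, Ch. VI of Cassels–Fröhlich (1967), §3.6 Prop. 6.

## Mathlib reuse

`AlgEquiv.restrictNormalHom`, `AlgEquiv.restrictNormalHom_apply`, `PowerBasis.algHom_ext`,
`IntermediateField.inclusion_injective`; from the tree: `LubinTateColemanSeries.lean` (`NormCoherentUnits`,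
`colemanSeries`, `eq_colemanSeries`), `LubinTateColemanInterpolation.lean` (`evalAt_cohPt_subst_hom`),
`LubinTateColemanNormCoherent.lean` (`galOfUnit`, `algEquiv_eq_of_mapPt_genPt_eq`), `LubinTateTowerRelNorm.lean`
(`algebraMap_towerNorm_ltField_eq_prod_stabilizer`), `LubinTateCharacterLimit.lean` (`lubinTateChar`,
`absGal_smul_ltAct_lubinTateChar`), `LubinTateCharacter.lean` (`ltGalCharEquiv`, `mapPt_ltAct'`),
`LubinTateTorsion.lean` (`toUnitBallHom`, `norm_algEquiv`, `isGalois_ltField`).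
-/

noncomputable section

open Filter Topology Polynomial ValuativeRel
open scoped PowerSeries.WithPiTopology

namespace Literature.NumberTheory.GaloisRepresentations

section LocalFieldCG

open GaloisRepresentations.IsNonarchimedeanLocalField LubinTate

variable (F : Type*) [Field F] [ValuativeRel F] [TopologicalSpace F] [IsNonarchimedeanLocalField F]

attribute [local instance] ltNormUniformSpace ltNormIsUniformAddGroup rk1 nF nE fintypeResidueField

variable {F}
variable {π : 𝒪[F]} (hπ : (valuation F).IsUniformizer (π : F)) (m : ℕ)

/-! ### `Gal(K_π^{m+1}/F)` is commutative; the restriction `Γ_F → Gal(K_π^{m+1}/F)` -/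

include hπ in
/-- **`Gal(K_π^{m+1}/F)` is commutative** (it is `≅ (𝒪_F/π^{m+1})ˣ` by the Lubin–Tate character).
[cite: CasselsFrohlichANT1967, Ch. VI §3.6 Prop. 6 (b)] -/
theorem algEquiv_mul_comm (σ τ : ltField π m ≃ₐ[F] ltField π m) : σ * τ = τ * σ :=
  algEquiv_eq_of_mapPt_genPt_eq hπ m (by
    rw [mapPt_mul, mapPt_mul, mapPt_genPt hπ m τ, mapPt_genPt hπ m σ, mapPt_ltAct', mapPt_ltAct',
      mapPt_genPt hπ m σ, mapPt_genPt hπ m τ, ltAct_comm])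

/-- The restriction of `σ ∈ Γ_F` to the normal extension `K_π^{m+1}/F`. [cite: deShalit1987, Ch. I §2.3 (iv)] -/
def galRestrict (σ : Field.absoluteGaloisGroup F) : ltField π m ≃ₐ[F] ltField π m :=
  haveI := isGalois_ltField hπ m
  AlgEquiv.restrictNormalHom (ltField π m) (Field.absoluteGaloisGroup.toAlgEquiv F σ)

/-- `galRestrict σ` acts as `σ` (in `F̄`). [cite: deShalit1987, Ch. I §2.3 (iv)] -/
theorem coe_galRestrict_apply (σ : Field.absoluteGaloisGroup F) (x : ltField π m) :
    ((galRestrict hπ m σ x : ltField π m) : AlgebraicClosure F) = σ • (x : AlgebraicClosure F) := by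
  haveI := isGalois_ltField hπ m
  rw [Field.absoluteGaloisGroup.smul_def]
  exact AlgEquiv.restrictNormalHom_apply (ltField π m) _ x

/-- `galRestrict` is multiplicative. [cite: deShalit1987, Ch. I §2.3 (iv)] -/
theorem galRestrict_mul (σ τ : Field.absoluteGaloisGroup F) :
    galRestrict hπ m (σ * τ) = galRestrict hπ m σ * galRestrict hπ m τ := by
  haveI := isGalois_ltField hπ m
  unfold galRestrict
  rw [map_mul, map_mul]

/-- `galRestrict 1 = 1`. [cite: deShalit1987, Ch. I §2.3 (iv)] -/
theorem galRestrict_one : galRestrict hπ m (1 : Field.absoluteGaloisGroup F) = 1 := by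
  haveI := isGalois_ltField hπ m
  unfold galRestrict
  rw [map_one, map_one]

/-- **`σ λ_{m+1} = [χ_π(σ)] λ_{m+1}`** for the restriction of `σ ∈ Γ_F`.
[cite: CasselsFrohlichANT1967, Ch. VI §3.4 Thm. 3 (b)] -/
theorem mapPt_galRestrict_genPt (σ : Field.absoluteGaloisGroup F) :
    mapPt (galRestrict hπ m σ) (genPt hπ m) = ltAct hπ m (lubinTateChar hπ σ : 𝒪[F]) (genPt hπ m) := by
  refine pt_ext ?_
  rw [coe_mapPt, coe_galRestrict_apply]
  have e1 : (((genPt hπ m : unitBall (ltField π m)) : ltField π m) : AlgebraicClosure F) =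
      (((ltAct hπ m 1 (genPt hπ m) : unitBall (ltField π m)) : ltField π m) : AlgebraicClosure F) := by
    rw [ltAct_one]
  rw [e1, absGal_smul_ltAct_lubinTateChar, mul_one]

/-- ★ **The restriction of `σ ∈ Γ_F` to `K_π^{m+1}` is `σ_{χ_π(σ)}`**, the automorphism with
`σ_v λ_{m+1} = [v] λ_{m+1}` for `v = χ_π(σ)`. [cite: CasselsFrohlichANT1967, Ch. VI §3.4 Thm. 3 (b)] -/
theorem galRestrict_eq_galOfUnit (σ : Field.absoluteGaloisGroup F) :
    galRestrict hπ m σ = galOfUnit hπ m (lubinTateChar hπ σ) :=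
  algEquiv_eq_of_mapPt_genPt_eq hπ m (by rw [mapPt_galRestrict_genPt, mapPt_galOfUnit_genPt])

/-- `σ_v ω_{m+1} = [v] ω_{m+1}` for the generator `ω_{m+1} = [u_m] λ_{m+1}` of the Tate module.
[cite: deShalit1987, Ch. I §2.3 (iv)] -/
theorem mapPt_galOfUnit_cohPt (v : 𝒪[F]ˣ) :
    mapPt (galOfUnit hπ m v) (cohPt hπ m) = ltAct hπ m (v : 𝒪[F]) (cohPt hπ m) := by
  rw [cohPt_eq, mapPt_ltAct', mapPt_galOfUnit_genPt, ltAct_comm]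

/-! ### Compatibility of `σ_v` with the tower and with the relative norms -/

/-- `σ_v` at level `m+1` maps the image of `ω_{n+1}` to the image of `σ_v ω_{n+1}` (`n ≤ m`).
[cite: deShalit1987, Ch. I §2.3 (iv)] -/
theorem mapPt_galOfUnit_inclPt_cohPt {n m : ℕ} (hnm : n ≤ m) (v : 𝒪[F]ˣ) :
    mapPt (galOfUnit hπ m v) (inclPt (ltField_mono hπ hnm) (cohPt hπ n)) =
      inclPt (ltField_mono hπ hnm) (mapPt (galOfUnit hπ n v) (cohPt hπ n)) := by
  rw [← ltAct_pow_sub_cohPt hπ hnm, mapPt_ltAct', mapPt_galOfUnit_cohPt, mapPt_galOfUnit_cohPt,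
    inclPt_ltAct_of_le hπ, ← ltAct_pow_sub_cohPt hπ hnm, ltAct_comm]

/-- **The `σ_v` are compatible with the tower**: `σ_v^{(m)} ∘ ι = ι ∘ σ_v^{(n)}` on `K_π^{n+1} ⊆ K_π^{m+1}`
(both are `F`-algebra maps agreeing on the generator `λ_{n+1}`). [cite: deShalit1987, Ch. I §2.3 (iv)] -/
theorem galOfUnit_inclusion {n m : ℕ} (hnm : n ≤ m) (v : 𝒪[F]ˣ) (y : ltField π n) :
    galOfUnit hπ m v (IntermediateField.inclusion (ltField_mono hπ hnm) y) =
      IntermediateField.inclusion (ltField_mono hπ hnm) (galOfUnit hπ n v y) := by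
  have hint := isIntegral_ltRoot π n
  set pb := IntermediateField.adjoin.powerBasis hint with hpb
  -- agreement on `ω_{n+1}`, then on `λ_{n+1} = [u_n⁻¹] ω_{n+1}`
  have hgen : mapPt (galOfUnit hπ m v) (inclPt (ltField_mono hπ hnm) (genPt hπ n)) =
      inclPt (ltField_mono hπ hnm) (mapPt (galOfUnit hπ n v) (genPt hπ n)) := by
    have e : genPt hπ n = ltAct hπ n ((cohUnit hπ n)⁻¹ : 𝒪[F]ˣ) (cohPt hπ n) := by
      rw [cohPt_eq, ← ltAct_mul, Units.inv_mul, ltAct_one]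
    rw [e, inclPt_ltAct_of_le hπ, mapPt_ltAct', mapPt_galOfUnit_inclPt_cohPt hπ hnm, mapPt_ltAct',
      inclPt_ltAct_of_le hπ]
  have hgen' : galOfUnit hπ m v (IntermediateField.inclusion (ltField_mono hπ hnm)
      (IntermediateField.AdjoinSimple.gen F (ltRoot π n))) =
      IntermediateField.inclusion (ltField_mono hπ hnm)
        (galOfUnit hπ n v (IntermediateField.AdjoinSimple.gen F (ltRoot π n))) := by
    have h1 := congrArg (fun z : (maxNilIdeal F (ltField π m)).toIdeal =>
      ((z : unitBall (ltField π m)) : ltField π m)) hgen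
    simp only [coe_mapPt] at h1
    exact h1
  have key : ((galOfUnit hπ m v : ltField π m ≃ₐ[F] ltField π m) : ltField π m →ₐ[F] ltField π m).comp
      (IntermediateField.inclusion (ltField_mono hπ hnm)) =
      (IntermediateField.inclusion (ltField_mono hπ hnm)).comp
        (galOfUnit hπ n v : ltField π n ≃ₐ[F] ltField π n) := by
    refine pb.algHom_ext ?_
    rw [hpb, IntermediateField.adjoin.powerBasis_gen hint, AlgHom.comp_apply, AlgHom.comp_apply]
    exact hgen'
  exact congrArg (fun φ : ltField π n →ₐ[F] ltField π m => φ y) key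

open scoped Classical in
/-- **Automorphisms commute with the relative norm**: `N_{K_π^{m+1}/K_π^{n+1}}(σ_v x) = σ_v(N_{K_π^{m+1}/K_π^{n+1}} x)`
(`Gal(K_π^{m+1}/F)` is abelian). [cite: deShalit1987, Ch. I §2.3 (iv)] -/
theorem algEquiv_towerNorm {n m : ℕ} (hnm : n ≤ m) (v : 𝒪[F]ˣ) (x : ltField π m) :
    @Algebra.norm (ltField π n) (ltField π m) _ _ (towerAlgebra (ltField_mono hπ hnm)) (galOfUnit hπ m v x) =
      galOfUnit hπ n v
        (@Algebra.norm (ltField π n) (ltField π m) _ _ (towerAlgebra (ltField_mono hπ hnm)) x) := by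
  classical
  refine IntermediateField.inclusion_injective (ltField_mono hπ hnm) ?_
  rw [algebraMap_towerNorm_ltField_eq_prod_stabilizer hπ hnm, ← galOfUnit_inclusion hπ hnm,
    algebraMap_towerNorm_ltField_eq_prod_stabilizer hπ hnm, map_prod]
  refine Finset.prod_congr rfl fun τ _ => ?_
  change (τ * galOfUnit hπ m v) x = (galOfUnit hπ m v * τ) x
  rw [algEquiv_mul_comm hπ m]

/-! ### The actions of `𝒪_Fˣ` and `Γ_F` on `𝒰` -/

namespace NormCoherentUnits

variable {hπ}

/-- **`σ_v β = (σ_v β_m)_m`**: the action of `v ∈ 𝒪_Fˣ ≅ Gal(K_π^∞/F)` on norm-coherent unit sequences.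
[cite: deShalit1987, Ch. I §2.3 (iv)] -/
def unitAct (v : 𝒪[F]ˣ) (β : NormCoherentUnits hπ) : NormCoherentUnits hπ where
  val m := toUnitBallHom (galOfUnit hπ m v) (β.val m)
  norm_eq_one m := by rw [coe_toUnitBallHom, norm_algEquiv]; exact β.norm_eq_one m
  coherent n m hnm := by
    rw [coe_toUnitBallHom, coe_toUnitBallHom, algEquiv_towerNorm hπ hnm, β.coherent n m hnm]

/-- Components of `unitAct v β`. [cite: deShalit1987, Ch. I §2.3 (iv)] -/
theorem coe_val_unitAct (v : 𝒪[F]ˣ) (β : NormCoherentUnits hπ) (m : ℕ) :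
    (((β.unitAct v).val m : unitBall (ltField π m)) : ltField π m) =
      galOfUnit hπ m v ((β.val m : unitBall (ltField π m)) : ltField π m) := rfl

/-- **`σ β = (σ β_m)_m`**: the action of `σ ∈ Γ_F` on norm-coherent unit sequences.
[cite: deShalit1987, Ch. I §2.3 (iv)] -/
def galAct (σ : Field.absoluteGaloisGroup F) (β : NormCoherentUnits hπ) : NormCoherentUnits hπ where
  val m := toUnitBallHom (galRestrict hπ m σ) (β.val m)
  norm_eq_one m := by rw [coe_toUnitBallHom, norm_algEquiv]; exact β.norm_eq_one m
  coherent n m hnm := by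
    rw [coe_toUnitBallHom, coe_toUnitBallHom, galRestrict_eq_galOfUnit, galRestrict_eq_galOfUnit,
      algEquiv_towerNorm hπ hnm, β.coherent n m hnm]

/-- Components of `galAct σ β`: `(σβ)_m = σ β_m` in `F̄`. [cite: deShalit1987, Ch. I §2.3 (iv)] -/
theorem coe_val_galAct (σ : Field.absoluteGaloisGroup F) (β : NormCoherentUnits hπ) (m : ℕ) :
    ((((β.galAct σ).val m : unitBall (ltField π m)) : ltField π m) : AlgebraicClosure F) =
      σ • (((β.val m : unitBall (ltField π m)) : ltField π m) : AlgebraicClosure F) :=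
  coe_galRestrict_apply hπ m σ _

/-- `σ` acts on `𝒰` through `χ_π(σ)`: `σβ = σ_{χ_π(σ)} β`. [cite: deShalit1987, Ch. I §2.3 (iv)] -/
theorem galAct_eq_unitAct (σ : Field.absoluteGaloisGroup F) (β : NormCoherentUnits hπ) :
    β.galAct σ = β.unitAct (lubinTateChar hπ σ) :=
  NormCoherentUnits.ext fun m => Subtype.ext (by
    rw [coe_val_unitAct, ← galRestrict_eq_galOfUnit]; rfl)

/-- `unitAct 1 = id`. [cite: deShalit1987, Ch. I §2.3 (iv)] -/
theorem unitAct_one (β : NormCoherentUnits hπ) : β.unitAct 1 = β :=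
  NormCoherentUnits.ext fun m => Subtype.ext (by
    rw [coe_val_unitAct]
    have h1 : galOfUnit hπ m 1 = 1 := by unfold galOfUnit; rw [map_one, map_one]
    rw [h1]; rfl)

/-- `unitAct (v w) = unitAct v ∘ unitAct w`. [cite: deShalit1987, Ch. I §2.3 (iv)] -/
theorem unitAct_mul (v w : 𝒪[F]ˣ) (β : NormCoherentUnits hπ) : β.unitAct (v * w) = (β.unitAct w).unitAct v :=
  NormCoherentUnits.ext fun m => Subtype.ext (by
    rw [coe_val_unitAct, coe_val_unitAct, coe_val_unitAct]
    have h1 : galOfUnit hπ m (v * w) = galOfUnit hπ m v * galOfUnit hπ m w := by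
      unfold galOfUnit; rw [map_mul, map_mul]
    rw [h1]; rfl)

/-- `galAct 1 = id`. [cite: deShalit1987, Ch. I §2.3 (iv)] -/
theorem galAct_one (β : NormCoherentUnits hπ) : β.galAct 1 = β :=
  NormCoherentUnits.ext fun m => Subtype.ext (by
    change galRestrict hπ m 1 _ = _
    rw [galRestrict_one]; rfl)

/-- `galAct (σ τ) = galAct σ ∘ galAct τ`. [cite: deShalit1987, Ch. I §2.3 (iv)] -/
theorem galAct_mul (σ τ : Field.absoluteGaloisGroup F) (β : NormCoherentUnits hπ) :
    β.galAct (σ * τ) = (β.galAct τ).galAct σ :=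
  NormCoherentUnits.ext fun m => Subtype.ext (by
    change galRestrict hπ m (σ * τ) _ = galRestrict hπ m σ (galRestrict hπ m τ _)
    rw [galRestrict_mul]; rfl)

/-- The actions commute with the product on `𝒰`. [cite: deShalit1987, Ch. I §2.3 (iv)] -/
theorem unitAct_mul_mul (v : 𝒪[F]ˣ) (β β' : NormCoherentUnits hπ) :
    (β.mul β').unitAct v = (β.unitAct v).mul (β'.unitAct v) :=
  NormCoherentUnits.ext fun m => Subtype.ext (by
    rw [coe_val_unitAct, val_mul, val_mul, Subring.coe_mul, Subring.coe_mul, map_mul, coe_val_unitAct,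
      coe_val_unitAct])

end NormCoherentUnits

/-! ### ★ Galois equivariance of `β ↦ g_β` -/

/-- ★ **`g_{σ_v β} = g_β ∘ [v]_f`** (de Shalit I Cor. 2.3 (iv)): the Coleman power series of `σ_v β` is
`g_β ∘ [v]_f` — both interpolate `σ_v β_m = σ_v(g_β(ω_{m+1})) = g_β(σ_v ω_{m+1}) = g_β([v] ω_{m+1})` at every
`ω_{m+1}`. [cite: deShalit1987, Ch. I §2.3 (iv)] -/
theorem colemanSeries_unitAct (v : 𝒪[F]ˣ) (β : NormCoherentUnits hπ) :
    colemanSeries hπ (β.unitAct v) =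
      PowerSeries.subst (hom (isLTRing_LTCoeff hπ) (isLTSeries_LTCoeff π) (isLTSeries_LTCoeff π)
        (LTCoeff.of F (v : 𝒪[F]))) (colemanSeries hπ β) := by
  refine (eq_colemanSeries hπ fun m => Subtype.ext ?_).symm
  rw [evalAt_cohPt_subst_hom hπ v, evalAt_cohPt_colemanSeries, NormCoherentUnits.coe_val_unitAct]

/-- ★ **`g_{σβ} = g_β ∘ [χ_π(σ)]_f` for `σ ∈ Γ_F`** (de Shalit I Cor. 2.3 (iv), (15) of §3.7 in the absolute
case): Coleman's isomorphism `𝒰 ≅ ℳ_f`, `β ↦ g_β`, is `Γ_F`-equivariant for the action `g ↦ g ∘ [χ_π(σ)]_f`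
on `𝒩`-invariant power series. [cite: deShalit1987, Ch. I §2.3 (iv)] -/
theorem colemanSeries_galAct (σ : Field.absoluteGaloisGroup F) (β : NormCoherentUnits hπ) :
    colemanSeries hπ (β.galAct σ) =
      PowerSeries.subst (hom (isLTRing_LTCoeff hπ) (isLTSeries_LTCoeff π) (isLTSeries_LTCoeff π)
        (LTCoeff.of F (lubinTateChar hπ σ : 𝒪[F]))) (colemanSeries hπ β) := by
  rw [NormCoherentUnits.galAct_eq_unitAct, colemanSeries_unitAct]

/-- **The values transform accordingly**: `σ (g_β(ω_{m+1})) = (g_β ∘ [χ_π(σ)])(ω_{m+1})` in `F̄`.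
[cite: deShalit1987, Ch. I §2.3 (iv)] -/
theorem absGal_smul_evalAt_cohPt_colemanSeries (σ : Field.absoluteGaloisGroup F) (β : NormCoherentUnits hπ) (m : ℕ) :
    σ • ((((evalAt (maxNilIdeal F (ltField π m)) (cohPt hπ m) (colemanSeries hπ β)) : unitBall (ltField π m)) :
      ltField π m) : AlgebraicClosure F) =
      (((evalAt (maxNilIdeal F (ltField π m)) (cohPt hπ m)
        (PowerSeries.subst (hom (isLTRing_LTCoeff hπ) (isLTSeries_LTCoeff π) (isLTSeries_LTCoeff π)
          (LTCoeff.of F (lubinTateChar hπ σ : 𝒪[F]))) (colemanSeries hπ β)) : unitBall (ltField π m)) :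
        ltField π m) : AlgebraicClosure F) := by
  rw [← colemanSeries_galAct, evalAt_cohPt_colemanSeries, evalAt_cohPt_colemanSeries,
    NormCoherentUnits.coe_val_galAct]

end LocalFieldCG

end Literature.NumberTheory.GaloisRepresentations
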